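import Mathlib

/-!
# SoloBlind — bi-planar wedge forms: the linear-algebra kernel of THEOREM BΛF

Solo residency `solo-HodgeConjecture-blind`, session s38 (part 2), note `work/s38/two-family.md` §3.
In the proof of THEOREM BΛF(ii) (two planar incidence families with full monodromy
`G₀ ⊇ A_{d₁} × A_{d₂}`), averaging a vanishing sum of cross wedge forms over the stabiliser of a
pair and using the star relations yields, for the `d₁ × d₂` matrix `W` of coefficients, the
"doubly centred" identity `(d₁·1 − J) · W · (d₂·1 − J) = 0` (entrywise:
`d₁ d₂ W_{ij} − d₂ Σ_k W_{kj} − d₁ Σ_l W_{il} + Σ_{k,l} W_{kl} = 0`), and the conclusion needed is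
that `W` is a sum of a row-constant and a column-constant matrix (i.e. lies in the star module).
This file certifies exactly that linear-algebra step and its converse, over any field in which
`d₁, d₂ ≠ 0`. The geometry (dominance, Freitag descent, the representation count) is prose.
-/

namespace Summit.HodgeConjecture.HodgeConjecture.Theorems.SoloBlindBiPlanarKernel

open Finset

/-- If the doubly centred matrix of `W` vanishes then `W i j = r i + c j` for suitable `r`, `c`. -/
theorem rowcol_of_doubly_centred_zero {K : Type*} [Field K] {m n : ℕ}
    (W : Fin m → Fin n → K) (hm : (m : K) ≠ 0) (hn : (n : K) ≠ 0)
    (h : ∀ i j, (m : K) * n * W i j - n * (∑ k, W k j) - m * (∑ l, W i l)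
      + ∑ k, ∑ l, W k l = 0) :
    ∃ r : Fin m → K, ∃ c : Fin n → K, ∀ i j, W i j = r i + c j := by
  refine ⟨fun i => (∑ l, W i l) / n - (∑ k, ∑ l, W k l) / (m * n), fun j => (∑ k, W k j) / m, ?_⟩
  intro i j
  have hmn : (m : K) * n ≠ 0 := mul_ne_zero hm hn
  have key : W i j = ((n : K) * (∑ k, W k j) + m * (∑ l, W i l) - ∑ k, ∑ l, W k l) / (m * n) := by
    rw [eq_div_iff hmn]
    linear_combination h i j
  rw [key]
  field_simp
  ring

/-- Conversely, every row-plus-column matrix is killed by double centring. -/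
theorem doubly_centred_zero_of_rowcol {K : Type*} [Field K] {m n : ℕ}
    (r : Fin m → K) (c : Fin n → K) (i : Fin m) (j : Fin n) :
    (m : K) * n * (r i + c j) - n * (∑ k, (r k + c j)) - m * (∑ l, (r i + c l))
      + ∑ k, ∑ l, (r k + c l) = 0 := by
  simp only [sum_add_distrib, sum_const, card_univ, Fintype.card_fin, nsmul_eq_mul]
  rw [← Finset.mul_sum]
  ring

/-- Left centring: the `(i,l)` entry of `(m·1 − J) W`. -/
theorem left_centred_entry {K : Type*} [Field K] {m n : ℕ}
    (W : Matrix (Fin m) (Fin n) K) (i : Fin m) (l : Fin n) :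
    ((((m : K) • (1 : Matrix (Fin m) (Fin m) K) - Matrix.of (fun (_ : Fin m) (_ : Fin m) => (1 : K)))
      * W) i l) = (m : K) * W i l - ∑ k, W k l := by
  rw [Matrix.mul_apply]
  simp only [Matrix.sub_apply, Matrix.smul_apply, Matrix.one_apply, Matrix.of_apply, smul_eq_mul,
    mul_ite, mul_one, mul_zero, sub_mul, ite_mul, zero_mul, one_mul, sum_sub_distrib]
  congr 1
  rw [Finset.sum_ite_eq]
  simp

/-- Right centring: the `(i,j)` entry of `N (n·1 − J)`. -/
theorem right_centred_entry {K : Type*} [Field K] {m n : ℕ}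
    (N : Matrix (Fin m) (Fin n) K) (i : Fin m) (j : Fin n) :
    ((N * ((n : K) • (1 : Matrix (Fin n) (Fin n) K) - Matrix.of (fun (_ : Fin n) (_ : Fin n) => (1 : K))))
      i j) = (n : K) * N i j - ∑ l, N i l := by
  rw [Matrix.mul_apply]
  simp only [Matrix.sub_apply, Matrix.smul_apply, Matrix.one_apply, Matrix.of_apply, smul_eq_mul,
    mul_ite, mul_one, mul_zero, mul_sub, sum_sub_distrib]
  congr 1
  rw [Finset.sum_ite_eq']
  simp [mul_comm]

/-- The entrywise expression of the first two theorems IS the `(i,j)` entry of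
`(m·1 − J) W (n·1 − J)`, `J` the all-ones matrices: so together they describe exactly the kernel
of double centring (= the star module of THEOREM BΛF). -/
theorem doubly_centred_entry {K : Type*} [Field K] {m n : ℕ}
    (W : Matrix (Fin m) (Fin n) K) (i : Fin m) (j : Fin n) :
    (((m : K) • (1 : Matrix (Fin m) (Fin m) K) - Matrix.of (fun (_ : Fin m) (_ : Fin m) => (1 : K)))
      * W *
      ((n : K) • (1 : Matrix (Fin n) (Fin n) K) - Matrix.of (fun (_ : Fin n) (_ : Fin n) => (1 : K))))
      i j
      = (m : K) * n * W i j - n * (∑ k, W k j) - m * (∑ l, W i l) + ∑ k, ∑ l, W k l := by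
  rw [right_centred_entry]
  simp only [left_centred_entry, sum_sub_distrib]
  rw [← Finset.mul_sum, Finset.sum_comm]
  ring

/-- The invariant count used in BΛF(iii): with both families transitive (`r₁ = r₂ = 1`) the
dimension `(r₁₂ − r₁ − r₂ + 1)·g₁g₂` of `((Std₁ ⊠ Std₂) ⊗ W)^H` equals `(r₁₂ − 1)·g₁g₂`, and
`p_g ≤ 1 < g₁ g₂` forces `r₁₂ = 1` (one `H`-orbit on pairs of letters, hence lemma FP). -/
theorem one_orbit_of_pg_le_one (r12 g1 g2 pg : ℕ) (hr : 1 ≤ r12) (hg : 2 ≤ g1 * g2)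
    (hpg : pg ≤ 1) (hforms : (r12 - 1) * (g1 * g2) ≤ pg) : r12 = 1 := by
  rcases Nat.lt_or_ge 1 r12 with h | h
  · exfalso
    have : 1 * (g1 * g2) ≤ (r12 - 1) * (g1 * g2) := Nat.mul_le_mul_right _ (by omega)
    omega
  · omega

end Summit.HodgeConjecture.HodgeConjecture.Theorems.SoloBlindBiPlanarKernel
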